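import Literature.MathematicalPhysics.QuantumFieldTheory.Balaban1983to89.Step
import Literature.MathematicalPhysics.QuantumFieldTheory.Balaban1983to89.Missing
import Literature.MathematicalPhysics.QuantumFieldTheory.Balaban1983to89.B12Beta

/-!
# `Balaban1983to89.FlowStep` — the located flow step of [Balaban1987RG1] Theorem 2 with HISTORY-DEPENDENT
β-functions: forward shooting (kernel-checked), the necessary/sufficient inputs, and the typed missing estimate

CITATION HEADER (lean-in-tree rule 2026-08-18).  This module belongs to the TYPED SKELETON of the published series
T. Bałaban, *Renormalization group approach to lattice gauge field theories. I. Generation of effective actions in a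
small field approximation and a coupling constant renormalization in four dimensions*, Commun. Math. Phys. **109**,
249–301 (1987), doi:10.1007/bf01215223 [Balaban1987RG1] (cell paper B12; journal page = PDF page + 248), read together
with *Large field renormalization. II*, Commun. Math. Phys. **122**, 355–392 (1989) [Balaban1989LargeFieldII] (B16).
WHAT IS REPRODUCED: the coupling-constant recursion (0.18)/(0.20) p. 255–256 with the β-functions typed AS PRINTED on
p. 298 — "We write β_j as explicitly dependent on g_{j−1}, although it depends also on all preceding coupling
constants" — i.e. `β_{k+1} = β_{k+1}(g_0, …, g_k)`; Theorem 2 p. 259 ((0.31)) as the TARGET SHAPE; and, kernel-checked,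
the elementary real analysis that reduces Theorem 2 to properties of these functions.  NOTHING of the series is
asserted: Theorem 2 is STATED WITHOUT PROOF in print (p. 259: "A proof of this theorem, based on perturbative
calculations, will be given in a separate paper"; [Balaban1989LargeFieldII] p. 355: "has not been published yet") and
is a CLAIM UNDER ADJUDICATION by the audit cell `pub-balaban` (unit `b2b-balaban-strat-b12`, located step T09.F).
The `def … : Prop` of §5 are the cell's TYPING of the unprinted input — hypotheses, never facts.

WHY THIS MODULE (census rows GAPS.md G-ref2-1 / G-adv2-4 / G-ref2-2).  The sibling module `Step` (unit f2) proves
`Step.couplingTrajectory_exists`: Thm 2 follows from continuity and `0 < b ≤ β_j ≤ β'` for a MARKOVIAN family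
`β : ℕ → ℝ → ℝ` by a BACKWARD intermediate-value sweep from `g_K = g`.  With the printed history dependence the
backward step is ill-posed (β_{k+1} needs g_0, …, g_{k−1}, not yet chosen).  Here the reduction is re-proved by
FORWARD SHOOTING in the bare coupling `g_0` (`couplingTrajectory_exists_hist`), for `β_{k+1}` continuous on the boxes
`]0,γ]^{k+1}` with `b ≤ β_{k+1} ≤ β'` there — and with the SHARPER hypothesis `0 ≤ b`: the existence of a bare
coupling whose trajectory stays in `]0,γ]`, is non-decreasing and ends at `g_K = g` (the hypothesis of
[Balaban1989LargeFieldII] Thm 1 together with the renormalization condition) needs only the SIGN `β_{k+1} ≥ 0`;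
the positive lower bound `b > 0` is what the logarithmic running (0.31) with `β > 0` adds.  Conversely (§4) the lower
half of (0.31) forces only SUFFIX-AVERAGED positivity of the β's along the trajectory, not a pointwise bound
(kernel witness `suffix_lower_not_pointwise`, REFEREE R6.2).  §6 transports the reduction to the construction level
(`Missing.B12Thm2Shape`, the cell's typing of Thm 2 over `Setup.Flow`) for flows generated forward from the bare
coupling, superseding the Markov-only `Missing.B12Thm2Shape_of_betaBounds` in scope.

WHAT IS PRINTED ABOUT THE β-FUNCTIONS (all of it): p. 255 (existence of β_1 ASSUMED: "Now we assume the existence of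
the first function"); p. 264 (1.20)–(1.22) (definition via the vacuum polarization tensor, second moment (1.22); "It
is a smooth function defined on the interval [0, γ], (or analytic), uniformly bounded on this interval together with
all derivatives. We will investigate other properties in a separate paper."); §5 pp. 292–298 ((5.37) representation,
(5.42) "the fundamental equality defining the β-function", (5.10)/(5.44) exponential bounds ⇒ a uniform UPPER bound);
p. 298 (history dependence, quoted above).  NO printed statement gives a SIGN, a LOWER BOUND, or the small-coupling
ASYMPTOTICS of β_j ([Balaban1989LargeFieldII] p. 355: the proof "based on second order perturbative calculations, is
very awkward and long … and has not been published yet").  Cell prose: HOME/b2b-balaban-strat-b12/MISSING-B12.md.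

Imports `Step` (raw-sequence predicates `RGEq`, `InInterval`, `Discrete031`, `BetaLower/Upper`, the Markov theorem),
`Missing` (`params4`, `B12Thm2Shape`) and (v1.1, §7) `B12Beta` (paper sub-cell B12's PRINTED ONE-LOOP SPLIT
`OneLoopSplit`, (2.12)–(2.14) p. 268: `β_{k+1} = β⁰_{k+1} + β¹_{k+1}(g_0,…,g_k)`, `β⁰` coupling-free, `β¹ = 0` at
`g_k = 0`); restates nothing of them.  Mathlib only otherwise; no `sorry`/`axiom`.

REVISIONS.  v1 (p176429), v1.1 (§7, p176508).  v1.2 (this file; DOCFIX only — no declaration added, removed or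
changed): the RIGIDITY CAVEAT on `BetaPertH` (§5 and its docstring), answering the typing audit GAPS.md G-adv2-18
(sibling module `BetaPertRigid`, which imports this one): a k-INDEPENDENT leading coefficient `β̄` together with the
printed one-loop split forces the one-loop coefficients `β⁰_{k+1}` to be CONSTANT in k, which the cell does not expect
of [Balaban1987RG1] (1.22) (the finite-lattice one-loop coefficient depends on k through the fine lattice `η = L^{−k}`,
cell DIVERGENCE D-b12-3, HOME/BETA/AN1.md §5); the dischargeable successors of `BetaPertH` are named in §5.  Nothing
is asserted about the series by this revision either.
-/

namespace Literature.MathematicalPhysics.QuantumFieldTheory.Balaban1983to89.FlowStep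

open Literature.MathematicalPhysics.QuantumFieldTheory.Balaban1983to89

noncomputable section

/-! ## 1. The recursion (0.20) with history-dependent β-functions (B12 p. 298) -/

/-- A family of HISTORY-DEPENDENT β-functions: `β k v` is Bałaban's `β_{k+1}` evaluated on the prefix
`v = (g_0, …, g_k)` of the coupling sequence — [Balaban1987RG1] p. 298 [PDF 50]: "We write β_j as explicitly dependent
on g_{j−1}, although it depends also on all preceding coupling constants."  (Index shift: `β k` ↔ printed `β_{k+1}`,
the function produced by the k-th fluctuation integral, (1.20)–(1.22) p. 264 with j = k.) [cite: Balaban1987RG1, §5 p.298 and (1.22) p.264] -/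
abbrev HBeta : Type := (k : ℕ) → (Fin (k + 1) → ℝ) → ℝ

/-- The prefix `(g_0, …, g_k)` of a coupling sequence, as a vector indexed by `Fin (k+1)`. [folklore] -/
def prefixOf (g : ℕ → ℝ) (k : ℕ) : Fin (k + 1) → ℝ := fun i => g i

/-- Unfolding of `prefixOf`. [folklore] -/
@[simp] theorem prefixOf_apply (g : ℕ → ℝ) (k : ℕ) (i : Fin (k + 1)) : prefixOf g k i = g i := rfl

/-- (0.18)/(0.20) p. 255–256 with history-dependent β: `1/g_k² = 1/g_{k+1}² + β_{k+1}(g_0, …, g_k)`, k = 0, …, K−1. [cite: Balaban1987RG1, (0.20) p.256] -/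
def RGEqH (K : ℕ) (β : HBeta) (g : ℕ → ℝ) : Prop :=
  ∀ k, k < K → 1 / (g k) ^ 2 = 1 / (g (k + 1)) ^ 2 + β k (prefixOf g k)

/-- The box `]0,γ]^{k+1}` of admissible prefixes ("defined on the interval [0, γ]", p. 264, for each argument). [cite: Balaban1987RG1, §1 p.264] -/
def Box (γ : ℝ) (k : ℕ) : Set (Fin (k + 1) → ℝ) := Set.pi Set.univ fun _ => Set.Ioc 0 γ

/-- Membership in the box, coordinatewise. [folklore] -/
theorem mem_box {γ : ℝ} {k : ℕ} {v : Fin (k + 1) → ℝ} : v ∈ Box γ k ↔ ∀ i, 0 < v i ∧ v i ≤ γ := by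
  simp [Box, Set.mem_Ioc]

/-- Uniform UPPER bound `β_{k+1} ≤ β'` on the boxes — PRINTED as an inductive property (p. 264 "uniformly bounded";
derivable from (5.10) + (5.42), cell GAPS G-adv2-3). [cite: Balaban1987RG1, §1 p.264] -/
def BetaUpperH (β' γ : ℝ) (β : HBeta) : Prop := ∀ k v, v ∈ Box γ k → β k v ≤ β'

/-- Uniform LOWER bound `b ≤ β_{k+1}` on the boxes.  `b = 0`: the SIGN of the β-functions; `b > 0`: (discrete)
ASYMPTOTIC FREEDOM.  NEITHER is asserted anywhere in print ([Balaban1987RG1] p. 264 defers "other properties" to a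
separate paper; [Balaban1989LargeFieldII] p. 355 "has not been published yet") — this is the located unprinted input
T09.F of the cell's DAG (`Dag.Leaves.betaPositive`), here in its history-dependent form. [cite: Balaban1987RG1, Thm 2 p.259 and §1 p.264] -/
def BetaLowerH (b γ : ℝ) (β : HBeta) : Prop := ∀ k v, v ∈ Box γ k → b ≤ β k v

/-- Joint continuity of each `β_{k+1}` on its box — p. 263–264 assert smoothness in the coupling ("It is a C^∞-function
of g_{j−1} ∈ [0,γ], (or analytic)"); no proof located in §§2–5 (cell GAPS G-adv2-3/G-adv2-6). [cite: Balaban1987RG1, §1 p.263–264] -/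
def BetaContH (γ : ℝ) (β : HBeta) : Prop := ∀ k, ContinuousOn (β k) (Box γ k)

/-- The Markovian special case of `Step`: `β_{k+1}` depending on `g_k` alone. [folklore] -/
def ofMarkov (βM : ℕ → ℝ → ℝ) : HBeta := fun k v => βM (k + 1) (v (Fin.last k))

/-- For Markovian families the history recursion IS `Step.RGEq` (so this module generalises, not replaces, `Step`). [folklore] -/
theorem rgEqH_ofMarkov_iff (K : ℕ) (βM : ℕ → ℝ → ℝ) (g : ℕ → ℝ) :
    RGEqH K (ofMarkov βM) g ↔ Step.RGEq K βM g := by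
  simp [RGEqH, Step.RGEq, ofMarkov, prefixOf, Fin.last]

/-- A Markov lower bound is a history lower bound for the embedded family. [folklore] -/
theorem betaLowerH_ofMarkov {b γ : ℝ} {βM : ℕ → ℝ → ℝ} (h : Step.BetaLower b γ βM) :
    BetaLowerH b γ (ofMarkov βM) := fun k v hv => h (k + 1) (v (Fin.last k)) (mem_box.mp hv _).1 (mem_box.mp hv _).2

/-- A Markov upper bound is a history upper bound for the embedded family. [folklore] -/
theorem betaUpperH_ofMarkov {β' γ : ℝ} {βM : ℕ → ℝ → ℝ} (h : Step.BetaUpper β' γ βM) :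
    BetaUpperH β' γ (ofMarkov βM) := fun k v hv => h (k + 1) (v (Fin.last k)) (mem_box.mp hv _).1 (mem_box.mp hv _).2

/-! ## 2. Telescoping and the discrete (0.31) along ONE trajectory (only trajectory-wise bounds are used) -/

/-- Telescoped (0.20): `1/g_m² = 1/g_n² + Σ_{j∈[m,n)} β_{j+1}(g_0,…,g_j)` for `m ≤ n ≤ K`. [cite: Balaban1987RG1, (0.20) p.256] -/
theorem inv_sq_telescopeH {K : ℕ} {β : HBeta} {g : ℕ → ℝ} (h : RGEqH K β g) {m n : ℕ} (hmn : m ≤ n)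
    (hn : n ≤ K) : 1 / (g m) ^ 2 = 1 / (g n) ^ 2 + ∑ j ∈ Finset.Ico m n, β j (prefixOf g j) := by
  induction n, hmn using Nat.le_induction with
  | base => simp
  | succ n hmn ih =>
    rw [Finset.sum_Ico_succ_top hmn, ih (Nat.le_of_succ_le hn), h n (Nat.lt_of_succ_le hn)]
    ring

/-- (0.31) in discrete form from TRAJECTORY-WISE two-sided bounds `b ≤ β_{j+1}(g_0,…,g_j) ≤ β'`, j < K
(`Step.Discrete031 b β' K (g K) g`: `1/g_K² + b(K−k) ≤ 1/g_k² ≤ 1/g_K² + β'(K−k)`). [cite: Balaban1987RG1, (0.31) p.259] -/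
theorem discrete031_of_trajBounds {K : ℕ} {β : HBeta} {g : ℕ → ℝ} {b β' : ℝ} (h : RGEqH K β g)
    (hlo : ∀ j, j < K → b ≤ β j (prefixOf g j)) (hhi : ∀ j, j < K → β j (prefixOf g j) ≤ β') :
    Step.Discrete031 b β' K (g K) g := by
  intro k hk
  have ht := inv_sq_telescopeH h hk le_rfl
  have hcard : ((Finset.Ico k K).card : ℝ) = (K : ℝ) - k := by
    rw [Nat.card_Ico, Nat.cast_sub hk]
  have hlo' : b * ((K : ℝ) - k) ≤ ∑ j ∈ Finset.Ico k K, β j (prefixOf g j) := by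
    rw [← hcard]
    have := Finset.card_nsmul_le_sum (Finset.Ico k K) (fun j => β j (prefixOf g j)) b
      (fun j hj => hlo j (Finset.mem_Ico.mp hj).2)
    rw [nsmul_eq_mul] at this
    linarith
  have hhi' : ∑ j ∈ Finset.Ico k K, β j (prefixOf g j) ≤ β' * ((K : ℝ) - k) := by
    rw [← hcard]
    have := Finset.sum_le_card_nsmul (Finset.Ico k K) (fun j => β j (prefixOf g j)) β'
      (fun j hj => hhi j (Finset.mem_Ico.mp hj).2)
    rw [nsmul_eq_mul] at this
    linarith
  constructor <;> linarith

/-! ## 3. FORWARD SHOOTING: Theorem 2's conclusion from `0 ≤ b ≤ β_{k+1} ≤ β'` and continuity on the boxes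

Construction.  From a trial bare coupling `g₀` run the recursion forward on `y_k = 1/g_k²`, feeding the β-functions
the CLAMPED couplings `ĝ(y) = (max(y, 1/γ²))^{-1/2} ∈ ]0,γ]` so that the map `g₀ ↦ y_K(g₀)` is defined and continuous on
all of `]0,∞[`.  Intermediate value theorem on `[g_small, γ]` with `1/g_small² = 1/g² + β'K`: `y_K(γ) ≤ 1/γ² ≤ 1/g²`
(each β ≥ 0) and `y_K(g_small) ≥ 1/g²` (each β ≤ β'), so some `g₀` has `y_K(g₀) = 1/g²`; along that run
`y_k ≥ y_K = 1/g² ≥ 1/γ²` (β ≥ 0), so the clamp never acted and the run is a genuine solution of (0.20) in `]0,γ]`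
with `g_K = g`.  No use of `b > 0` — it enters only the lower half of (0.31). -/

section Shooting

variable (β : HBeta) (γ : ℝ)

/-- The clamped coupling `ĝ(y) = 1/√(max(y, γ⁻²))`, always in `]0, γ]` (γ > 0). [folklore] -/
def gClamp (y : ℝ) : ℝ := 1 / Real.sqrt (max y (1 / γ ^ 2))

/-- Table of the clamped forward run: `ys k g₀ i = y_i(g₀)` for `i ≤ k` (structural recursion on `k`). [folklore] -/
def ys : ℕ → ℝ → ℕ → ℝ
  | 0, g₀ => fun _ => 1 / g₀ ^ 2
  | k + 1, g₀ => fun i =>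
      if i ≤ k then ys k g₀ i
      else ys k g₀ k - β k (fun j : Fin (k + 1) => gClamp γ (ys k g₀ j))

/-- `Y k g₀ = y_k(g₀)`, the clamped forward run of `1/g_k²` started at `y_0 = 1/g₀²`. [folklore] -/
def Y (k : ℕ) (g₀ : ℝ) : ℝ := ys β γ k g₀ k

variable {β γ}

/-- The table is stable: entries `i ≤ k` of row `k` are the values `y_i`. [folklore] -/
theorem ys_stable (g₀ : ℝ) : ∀ k i, i ≤ k → ys β γ k g₀ i = Y β γ i g₀ := by
  intro k
  induction k with
  | zero => intro i hi; obtain rfl := Nat.le_zero.mp hi; rfl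
  | succ k ih =>
    intro i hi
    rcases Nat.lt_or_eq_of_le hi with hlt | rfl
    · have hik : i ≤ k := Nat.lt_succ_iff.mp hlt
      have : ys β γ (k + 1) g₀ i = ys β γ k g₀ i := by simp [ys, hik]
      rw [this, ih i hik]
    · rfl

/-- `y_0 = 1/g₀²`. [folklore] -/
theorem Y_zero (g₀ : ℝ) : Y β γ 0 g₀ = 1 / g₀ ^ 2 := rfl

/-- The clamped recursion: `y_{k+1} = y_k − β_{k+1}(ĝ(y_0), …, ĝ(y_k))`. [folklore] -/
theorem Y_succ (k : ℕ) (g₀ : ℝ) :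
    Y β γ (k + 1) g₀ = Y β γ k g₀ - β k (fun j : Fin (k + 1) => gClamp γ (Y β γ j g₀)) := by
  have h1 : Y β γ (k + 1) g₀ = ys β γ k g₀ k - β k (fun j : Fin (k + 1) => gClamp γ (ys β γ k g₀ j)) := by
    show ys β γ (k + 1) g₀ (k + 1) = _
    simp [ys]
  rw [h1]
  have h2 : (fun j : Fin (k + 1) => gClamp γ (ys β γ k g₀ j))
      = fun j : Fin (k + 1) => gClamp γ (Y β γ j g₀) := by
    funext j
    rw [ys_stable g₀ k j (Nat.lt_succ_iff.mp j.isLt)]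
  rw [h2]
  rfl

/-- The clamped prefix fed to `β k` at trial coupling `g₀`. [folklore] -/
def clampPrefix (β : HBeta) (γ : ℝ) (k : ℕ) (g₀ : ℝ) : Fin (k + 1) → ℝ :=
  fun j => gClamp γ (Y β γ j g₀)

/-- The clamped recursion in terms of `clampPrefix`. [folklore] -/
theorem Y_succ' (k : ℕ) (g₀ : ℝ) : Y β γ (k + 1) g₀ = Y β γ k g₀ - β k (clampPrefix β γ k g₀) :=
  Y_succ k g₀

section clamp
variable (hγ : 0 < γ)
include hγ

/-- The clamped coupling is positive. [folklore] -/
theorem gClamp_pos (y : ℝ) : 0 < gClamp γ y := by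
  unfold gClamp
  have : 0 < max y (1 / γ ^ 2) := lt_max_of_lt_right (by positivity)
  exact div_pos one_pos (Real.sqrt_pos.mpr this)

/-- The clamped coupling is at most `γ`. [folklore] -/
theorem gClamp_le (y : ℝ) : gClamp γ y ≤ γ := by
  unfold gClamp
  have hm : 1 / γ ^ 2 ≤ max y (1 / γ ^ 2) := le_max_right _ _
  have hs : 1 / γ ≤ Real.sqrt (max y (1 / γ ^ 2)) := by
    rw [show (1 : ℝ) / γ = Real.sqrt ((1 / γ) ^ 2) by rw [Real.sqrt_sq (by positivity)]]
    exact Real.sqrt_le_sqrt (by rw [div_pow, one_pow]; exact hm)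
  have hspos : 0 < Real.sqrt (max y (1 / γ ^ 2)) := lt_of_lt_of_le (by positivity) hs
  rw [div_le_iff₀ hspos]
  calc (1 : ℝ) = γ * (1 / γ) := by field_simp
    _ ≤ γ * Real.sqrt (max y (1 / γ ^ 2)) := mul_le_mul_of_nonneg_left hs hγ.le

/-- Off the clamp (`y ≥ 1/γ²`) the clamped coupling is the genuine one: `1/ĝ(y)² = y`. [folklore] -/
theorem inv_sq_gClamp {y : ℝ} (hy : 1 / γ ^ 2 ≤ y) : 1 / (gClamp γ y) ^ 2 = y := by
  unfold gClamp
  have hypos : 0 < y := lt_of_lt_of_le (by positivity) hy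
  rw [max_eq_left hy, div_pow, one_pow, Real.sq_sqrt hypos.le, one_div_one_div]

omit hγ in
/-- Off the clamp, `ĝ(y) = 1/√y`. [folklore] -/
theorem gClamp_eq_of_le {y : ℝ} (hy : 1 / γ ^ 2 ≤ y) : gClamp γ y = 1 / Real.sqrt y := by
  unfold gClamp; rw [max_eq_left hy]

/-- The clamp is continuous (γ > 0). [folklore] -/
theorem continuous_gClamp : Continuous (gClamp γ) := by
  unfold gClamp
  refine Continuous.div continuous_const (Real.continuous_sqrt.comp (continuous_id.max continuous_const)) ?_
  intro y
  have : 0 < max y (1 / γ ^ 2) := lt_max_of_lt_right (by positivity)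
  exact (Real.sqrt_pos.mpr this).ne'

/-- `ĝ` is antitone: larger `y = 1/g²` means smaller coupling. [folklore] -/
theorem gClamp_antitone : Antitone (gClamp γ) := by
  intro y₁ y₂ h
  unfold gClamp
  have hpos : 0 < Real.sqrt (max y₁ (1 / γ ^ 2)) :=
    Real.sqrt_pos.mpr (lt_max_of_lt_right (by positivity))
  exact one_div_le_one_div_of_le hpos (Real.sqrt_le_sqrt (max_le_max h le_rfl))

/-- Clamped prefixes lie in the box `]0,γ]^{k+1}`. [folklore] -/
theorem clampPrefix_mem_box (k : ℕ) (g₀ : ℝ) : clampPrefix β γ k g₀ ∈ Box γ k :=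
  mem_box.mpr fun _ => ⟨gClamp_pos hγ _, gClamp_le hγ _⟩

omit hγ in
/-- The clamped run telescopes: `y_k = 1/g₀² − Σ_{j<k} β_{j+1}(clamped prefix)`. [folklore] -/
theorem Y_eq_sub_sum (k : ℕ) (g₀ : ℝ) :
    Y β γ k g₀ = 1 / g₀ ^ 2 - ∑ j ∈ Finset.range k, β j (clampPrefix β γ j g₀) := by
  induction k with
  | zero => simp [Y_zero]
  | succ k ih => rw [Y_succ', ih, Finset.sum_range_succ]; ring

omit hγ in
/-- Differences of the clamped run are partial sums of β's. [folklore] -/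
theorem Y_sub_Y {k K : ℕ} (hk : k ≤ K) (g₀ : ℝ) :
    Y β γ k g₀ - Y β γ K g₀ = ∑ j ∈ Finset.Ico k K, β j (clampPrefix β γ j g₀) := by
  rw [Y_eq_sub_sum k, Y_eq_sub_sum K, Finset.sum_Ico_eq_sub _ hk]; ring

variable {b β' : ℝ} (hlo : BetaLowerH b γ β) (hhi : BetaUpperH β' γ β)
include hlo hhi

/-- Two-sided control of the clamped run between steps `k ≤ K`: `b(K−k) ≤ y_k − y_K ≤ β'(K−k)`. [folklore] -/
theorem Y_sub_Y_bounds {k K : ℕ} (hk : k ≤ K) (g₀ : ℝ) :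
    b * ((K : ℝ) - k) ≤ Y β γ k g₀ - Y β γ K g₀ ∧ Y β γ k g₀ - Y β γ K g₀ ≤ β' * ((K : ℝ) - k) := by
  rw [Y_sub_Y hk]
  have hcard : ((Finset.Ico k K).card : ℝ) = (K : ℝ) - k := by rw [Nat.card_Ico, Nat.cast_sub hk]
  constructor
  · have := Finset.card_nsmul_le_sum (Finset.Ico k K) (fun j => β j (clampPrefix β γ j g₀)) b
      (fun j _ => hlo j _ (clampPrefix_mem_box hγ j g₀))
    rw [nsmul_eq_mul, hcard] at this
    linarith
  · have := Finset.sum_le_card_nsmul (Finset.Ico k K) (fun j => β j (clampPrefix β γ j g₀)) β'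
      (fun j _ => hhi j _ (clampPrefix_mem_box hγ j g₀))
    rw [nsmul_eq_mul, hcard] at this
    linarith

end clamp

/-- Continuity of the clamped run in the trial bare coupling, on `]0,∞[`. [folklore] -/
theorem continuousOn_Y (hγ : 0 < γ) (hcont : BetaContH γ β) :
    ∀ k, ContinuousOn (Y β γ k) (Set.Ioi 0) := by
  -- strong induction packaged as `∀ i ≤ k`
  suffices H : ∀ k i, i ≤ k → ContinuousOn (Y β γ i) (Set.Ioi 0) from fun k => H k k le_rfl
  intro k
  induction k with
  | zero =>
    intro i hi
    obtain rfl := Nat.le_zero.mp hi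
    have : Y β γ 0 = fun g₀ => 1 / g₀ ^ 2 := funext (Y_zero (β := β) (γ := γ))
    rw [this]
    exact continuousOn_const.div (continuous_pow 2).continuousOn fun x hx => pow_ne_zero 2 (ne_of_gt hx)
  | succ k ih =>
    intro i hi
    rcases Nat.lt_or_eq_of_le hi with hlt | rfl
    · exact ih i (Nat.lt_succ_iff.mp hlt)
    · have e : Y β γ (k + 1) = fun g₀ => Y β γ k g₀ - β k (clampPrefix β γ k g₀) :=
        funext (Y_succ' (β := β) (γ := γ) k)
      rw [e]
      refine (ih k le_rfl).sub ?_
      have hpre : ContinuousOn (fun g₀ => clampPrefix β γ k g₀) (Set.Ioi 0) := by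
        rw [continuousOn_pi]
        intro j
        exact (continuous_gClamp hγ).comp_continuousOn (ih j (Nat.lt_succ_iff.mp j.isLt))
      exact (hcont k).comp hpre fun g₀ _ => clampPrefix_mem_box hγ k g₀

/-- **[Balaban1987RG1] Thm 2 ⇐ (continuity ∧ `0 ≤ b ≤ β_{k+1} ≤ β'` on the boxes `]0,γ]^{k+1}`), HISTORY-DEPENDENT
β, by forward shooting.**  For every `K` and every renormalized `g ∈ ]0,γ]` there is a bare coupling `g_0` whose
forward trajectory under (0.20) exists up to step `K`, lies in `]0,γ]`, is non-decreasing, ends at `g_K = g`, and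
obeys the discrete two-sided running `1/g² + b(K−k) ≤ 1/g_k² ≤ 1/g² + β'(K−k)` (= (0.31) with `β log L = b`,
`β' log L = β'`, `Step.logRunning_iff_discrete031`).  `b = 0` IS ALLOWED: the interval statement and `g_K = g` need
only the SIGN of the β-functions; `b > 0` yields the logarithmic lower running.  This closes, at the kernel level,
the scope objection G-ref2-1/G-adv2-4 to the Markov reduction `Step.couplingTrajectory_exists`.  The hypotheses
`hlo` (any `b ≥ 0`) and `hcont` are NOT supplied by any printed source (module docstring); `hhi` is printed
(p. 264).  A REDUCTION, not a proof of Theorem 2. [cite: Balaban1987RG1, Thm 2 (0.31) p.259 and §5 p.298] -/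
theorem couplingTrajectory_exists_hist (β : HBeta) {γ b β' : ℝ} (hγ : 0 < γ) (hb : 0 ≤ b) (hbβ : b ≤ β')
    (hcont : BetaContH γ β) (hlo : BetaLowerH b γ β) (hhi : BetaUpperH β' γ β) :
    ∀ (K : ℕ) (g : ℝ), 0 < g → g ≤ γ →
      ∃ gs : ℕ → ℝ, gs K = g ∧ RGEqH K β gs ∧ Step.InInterval γ K gs ∧
        Step.Discrete031 b β' K g gs ∧ ∀ k, k < K → gs k ≤ gs (k + 1) := by
  intro K g hg hgγ
  have hβ' : 0 ≤ β' := hb.trans hbβ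
  -- the IVT window [g_small, γ], 1/g_small² = 1/g² + β' K
  set A : ℝ := 1 / g ^ 2 + β' * K with hA
  have hApos : 0 < A := by positivity
  set gsm : ℝ := 1 / Real.sqrt A with hgsm
  have hgsm_pos : 0 < gsm := by positivity
  have hgsm_sq : 1 / gsm ^ 2 = A := by
    rw [hgsm, div_pow, one_pow, Real.sq_sqrt hApos.le, one_div_one_div]
  have hgsm_le_g : gsm ≤ g := by
    have h1 : 1 / g ^ 2 ≤ 1 / gsm ^ 2 := by rw [hgsm_sq, hA]; linarith [mul_nonneg hβ' (Nat.cast_nonneg K)]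
    have h2 : gsm ^ 2 ≤ g ^ 2 := by rwa [one_div_le_one_div (by positivity) (by positivity)] at h1
    nlinarith [hgsm_pos, hg]
  have hgsm_le_γ : gsm ≤ γ := hgsm_le_g.trans hgγ
  -- continuity of f = y_K on the window
  have hfc : ContinuousOn (Y β γ K) (Set.Icc gsm γ) :=
    (continuousOn_Y hγ hcont K).mono fun x hx => lt_of_lt_of_le hgsm_pos hx.1
  -- endpoint values
  have hK0 := Y_sub_Y_bounds hγ hlo hhi (Nat.zero_le K)
  have hfγ : Y β γ K γ ≤ 1 / g ^ 2 := by
    have h := (hK0 γ).1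
    rw [Y_zero] at h
    have : 1 / γ ^ 2 ≤ 1 / g ^ 2 :=
      one_div_le_one_div_of_le (by positivity) (pow_le_pow_left₀ hg.le hgγ 2)
    have hKb : 0 ≤ b * ((K : ℝ) - 0) := by simp; positivity
    linarith
  have hfsm : 1 / g ^ 2 ≤ Y β γ K gsm := by
    have h := (hK0 gsm).2
    rw [Y_zero, hgsm_sq, hA] at h
    simp only [Nat.cast_zero, sub_zero] at h
    linarith
  -- intermediate value theorem
  obtain ⟨g₀, hg₀mem, hg₀⟩ :=
    intermediate_value_Icc' hgsm_le_γ hfc ⟨hfγ, hfsm⟩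
  have hg₀pos : 0 < g₀ := lt_of_lt_of_le hgsm_pos hg₀mem.1
  -- along the chosen run the clamp is inactive: y_k ≥ y_K = 1/g² ≥ 1/γ²
  have hγg : 1 / γ ^ 2 ≤ 1 / g ^ 2 :=
    one_div_le_one_div_of_le (by positivity) (pow_le_pow_left₀ hg.le hgγ 2)
  have hYk : ∀ k, k ≤ K → 1 / g ^ 2 + b * ((K : ℝ) - k) ≤ Y β γ k g₀ ∧
      Y β γ k g₀ ≤ 1 / g ^ 2 + β' * ((K : ℝ) - k) := by
    intro k hk
    have h := Y_sub_Y_bounds hγ hlo hhi hk g₀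
    rw [hg₀] at h
    constructor <;> linarith [h.1, h.2]
  have hYge : ∀ k, k ≤ K → 1 / γ ^ 2 ≤ Y β γ k g₀ := by
    intro k hk
    have := (hYk k hk).1
    have hnn : 0 ≤ b * ((K : ℝ) - k) := mul_nonneg hb (by
      have : (k : ℝ) ≤ K := by exact_mod_cast hk
      linarith)
    linarith
  -- the trajectory
  refine ⟨fun k => gClamp γ (Y β γ k g₀), ?_, ?_, ?_, ?_, ?_⟩
  · -- g_K = g
    show gClamp γ (Y β γ K g₀) = g
    rw [gClamp_eq_of_le (hYge K le_rfl), hg₀,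
      show (1 : ℝ) / g ^ 2 = (1 / g) ^ 2 by ring, Real.sqrt_sq (by positivity), one_div_one_div]
  · -- (0.20)
    intro k hk
    show 1 / (gClamp γ (Y β γ k g₀)) ^ 2 = 1 / (gClamp γ (Y β γ (k + 1) g₀)) ^ 2 + β k _
    rw [inv_sq_gClamp hγ (hYge k hk.le), inv_sq_gClamp hγ (hYge (k + 1) hk), Y_succ k g₀]
    have e : prefixOf (fun k => gClamp γ (Y β γ k g₀)) k = fun j : Fin (k + 1) => gClamp γ (Y β γ j g₀) := rfl
    rw [e]
    ring
  · -- ]0, γ]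
    intro k _
    exact ⟨gClamp_pos hγ _, gClamp_le hγ _⟩
  · -- discrete (0.31)
    intro k hk
    show 1 / g ^ 2 + b * ((K : ℝ) - k) ≤ 1 / (gClamp γ (Y β γ k g₀)) ^ 2 ∧
      1 / (gClamp γ (Y β γ k g₀)) ^ 2 ≤ 1 / g ^ 2 + β' * ((K : ℝ) - k)
    rw [inv_sq_gClamp hγ (hYge k hk)]
    exact hYk k hk
  · -- monotone (β ≥ 0)
    intro k hk
    apply gClamp_antitone hγ
    rw [Y_succ' k g₀]
    have := hlo k (clampPrefix β γ k g₀) (clampPrefix_mem_box (β := β) hγ k g₀)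
    linarith

end Shooting

/-- Corollary in the exact shape typed by the cell's adversarial reader (HOME/b2b-balaban-adv2/HistoryFlow.lean,
G-adv2-4), with `b > 0`. [cite: Balaban1987RG1, Thm 2 (0.31) p.259] -/
theorem couplingTrajectory_exists_history (β : HBeta) {γ b β' : ℝ} (hγ : 0 < γ) (hb : 0 < b) (hbβ : b ≤ β')
    (hcont : ∀ k, ContinuousOn (β k) (Box γ k))
    (hL : ∀ k p, p ∈ Box γ k → b ≤ β k p) (hU : ∀ k p, p ∈ Box γ k → β k p ≤ β') :
    ∀ (K : ℕ) (g : ℝ), 0 < g → g ≤ γ →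
      ∃ gs : ℕ → ℝ, gs K = g ∧ RGEqH K β gs ∧ (∀ k, k ≤ K → 0 < gs k ∧ gs k ≤ γ) ∧
        ∀ k, k ≤ K →
          1 / g ^ 2 + b * ((K : ℝ) - k) ≤ 1 / (gs k) ^ 2 ∧
            1 / (gs k) ^ 2 ≤ 1 / g ^ 2 + β' * ((K : ℝ) - k) := by
  intro K g hg hgγ
  obtain ⟨gs, hK, hrg, hI, hD, -⟩ := couplingTrajectory_exists_hist β hγ hb.le hbβ hcont hL hU K g hg hgγ
  exact ⟨gs, hK, hrg, hI, hD⟩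

/-- The SIGN alone: with `β_{k+1} ≥ 0` (and continuity, upper bound) every renormalized `g ∈ ]0,γ]` is reached at
step `K` by a non-decreasing trajectory inside `]0,γ]` — i.e. the standing hypothesis "g_k ∈ ]0,γ]" of
[Balaban1989LargeFieldII] Thm 1 together with the renormalization condition `g_K = g`, WITHOUT the logarithmic
running.  (Census refinement: of the unprinted input, only `β ≥ 0` is consumed by the end-statement's hypothesis;
`b > 0` is consumed by (0.31) and by [Balaban1988Convergent] (2.46), cf. `Step.sum_sixth_powers_le`.) [cite: Balaban1989LargeFieldII, Thm 1 p.355] -/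
theorem bare_coupling_exists_of_betaNonneg (β : HBeta) {γ β' : ℝ} (hγ : 0 < γ) (hβ' : 0 ≤ β')
    (hcont : BetaContH γ β) (hsign : BetaLowerH 0 γ β) (hhi : BetaUpperH β' γ β) :
    ∀ (K : ℕ) (g : ℝ), 0 < g → g ≤ γ →
      ∃ gs : ℕ → ℝ, gs K = g ∧ RGEqH K β gs ∧ Step.InInterval γ K gs ∧ ∀ k, k < K → gs k ≤ gs (k + 1) := by
  intro K g hg hgγ
  obtain ⟨gs, hK, hrg, hI, -, hmono⟩ := couplingTrajectory_exists_hist β hγ le_rfl hβ' hcont hsign hhi K g hg hgγ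
  exact ⟨gs, hK, hrg, hI, hmono⟩

/-! ## 4. What (0.31) FORCES about the β-functions (necessity side; REFEREE R6.2 / GAPS G-ref2-2)

The lower half of (0.31) along a solution of (0.20) is EQUIVALENT to lower bounds on the SUFFIX SUMS
`Σ_{j=k}^{K−1} β_{j+1}(g_0,…,g_j) ≥ b(K−k)`; it does not force a pointwise bound `β_{j+1} ≥ b`.  So a proof of
Theorem 2 must produce at least suffix-averaged positivity along its trajectories; the pointwise box bound of §3 is
a convenient SUFFICIENT form. -/

/-- (0.31)-lower ⟺ suffix-sum lower bounds, along a solution of (0.20). [cite: Balaban1987RG1, (0.31) p.259] -/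
theorem discrete031_lower_iff_suffix {K : ℕ} {β : HBeta} {g : ℕ → ℝ} {b : ℝ} (h : RGEqH K β g) :
    (∀ k, k ≤ K → 1 / (g K) ^ 2 + b * ((K : ℝ) - k) ≤ 1 / (g k) ^ 2) ↔
      ∀ k, k ≤ K → b * ((K : ℝ) - k) ≤ ∑ j ∈ Finset.Ico k K, β j (prefixOf g j) := by
  constructor
  · intro H k hk
    have := H k hk
    rw [inv_sq_telescopeH h hk le_rfl] at this
    linarith
  · intro H k hk
    rw [inv_sq_telescopeH h hk le_rfl]
    linarith [H k hk]

/-- Kernel witness that suffix positivity is strictly weaker than pointwise positivity: K = 2, b = 1, increments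
`β_1 = 0`, `β_2 = 3` (trajectory `1/g_0² = 1/g_1² = 4`, `1/g_2² = 1`): (0.20) and the lower (0.31) with b = 1 hold,
yet `β_1 = 0 < b`.  (Same phenomenon as the cell referee's witness `SuffixNotPointwise`, REFEREE R6.2.) [folklore] -/
theorem suffix_lower_not_pointwise :
    ∃ (β : HBeta) (g : ℕ → ℝ), RGEqH 2 β g ∧
      (∀ k : ℕ, k ≤ 2 → 1 / (g 2) ^ 2 + 1 * ((2 : ℝ) - (k : ℝ)) ≤ 1 / (g k) ^ 2) ∧
        β 0 (prefixOf g 0) < 1 := by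
  refine ⟨fun k _ => if k = 0 then 0 else 3, fun k => if k = 2 then 1 else 1 / 2, ?_, ?_, ?_⟩
  · intro k hk
    interval_cases k <;> norm_num
  · intro k hk
    interval_cases k <;> norm_num
  · norm_num

/-! ## 5. The located missing input, TYPED (hypotheses under adjudication — never facts)

Two strengths, both UNPRINTED for Bałaban's β-functions (1.22)/(5.42):
* `BetaSignH`  — non-negativity on the boxes: suffices (with continuity + the printed upper bound) for the bare
  coupling `g_0(ε, g)` and the interval hypothesis (`bare_coupling_exists_of_betaNonneg`);
* `BetaAFH`    — a uniform POSITIVE lower bound: suffices for the whole of Theorem 2 incl. (0.31)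
  (`couplingTrajectory_exists_hist`), and for [Balaban1988Convergent] (2.46) (`Step.sum_sixth_powers_le`).
`BetaPertH` is the cell's FIRST typing of the ROUTE TO IT that the author names — [Balaban1989LargeFieldII] p. 355:
"The proof of Theorem 2, which is based on second order perturbative calculations" — namely a uniform-in-k second-order
expansion `β_{k+1}(g_0,…,g_k) = β̄ + O(γ²)` on `]0,γ]^{k+1}` with a k-INDEPENDENT leading coefficient `β̄ > 0`;
`betaAFH_of_pert` checks that this implies `BetaAFH`.  What `β̄` should be is NOT printed in the series (the only
printed hint is [Balaban1989LargeFieldI] p. 175: "For d = 4 the bare coupling constant behaves asymptotically as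
(a + b log ε⁻¹)^{−1/2}, for ε → 0, with some positive constants a, b"); perturbation theory predicts, in the units of
(0.20) (the `1/g²` of (0.2) is the textbook `2N/g²`, cell module `B12Normalization`), `β̄ = 2N·2β₀ log L =
(11N²/12π²) log L`, `β₀ = 11N/(48π²)` (e.g. [MontvayMunster1994] (3.80)–(3.81) for the normalisation,
(3.259)–(3.264) for `β₀`) — recorded in the cell's
MISSING-B12.md as context only, not used here.

RIGIDITY CAVEAT (v1.2; census row G-adv2-18, kernel in the sibling module `BetaPertRigid`).  `BetaPertH β β̄` fixes ONE
k-independent `β̄`.  Combined with the printed one-loop split `B12Beta.OneLoopSplit β` ((2.12)–(2.14) p. 268: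
`β_{k+1} = β⁰_{k+1} + β¹_{k+1}`, `β¹_{k+1} = 0` at `g_k = 0`) and any remainder bound making `β¹_{k+1} → 0` as the
history tends to 0, it FORCES `β⁰_{k+1} = β̄` for every k (`BetaPertRigid.beta0_eq_of_pert`), and a family with two
distinct one-loop coefficients satisfies `BetaPertH β β̄` for NO `β̄` (`BetaPertRigid.not_betaPertH_of_two_scales`).
The one-loop coefficient of (1.22) is a Gaussian quantity of the k-th constrained fluctuation integral ((1.4) p. 260)
and depends on k through the fine lattice `η = L^{−k}` below the unit lattice (cell DIVERGENCE D-b12-3; the abelian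
model computation HOME/BETA/AN1.md §5 exhibits the k-dependence explicitly), so `BetaPertH` is presumably FALSE for
Bałaban's family even if Theorem 2 holds: it is kept as the record of the cell's first typing (consumers:
`thm2Printed_of_pertH`, `B12Thm2Shape_of_pertH`), NOT as the target.  The dischargeable successors, weakest sufficient
first: the partial-sum form `FlowStepRuns.BetaPartialSumsLowerH` (exactly what endpoint existence and the
[Balaban1989LargeFieldII] p. 355 reading need; §7 of that module), fed by the DRIFT form of the one-loop coefficients
(`Σ_{j<k} β⁰_{j+1} = b·k + O(1)`, `b > 0`; cell module `Beta/Drift`) or by the LIMIT form (`β⁰_{k+1} → β⁰_∞ > 0`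
geometrically; `FlowStepRuns` §10) together with (AF-1) `|β¹_{k+1}| ≤ C g_k`; and, for the literal (0.31) at every k,
(AF-0) `β⁰_{k+1} ≥ 2b > 0` for all k + (AF-1) (§7 below, `betaLowerH_of_split`).  None of these is printed for
Bałaban's β-functions; all are hypotheses under adjudication (cell HOME/BETA-SPEC.md, MISSING-B12.md). -/

/-- (β-sign)_hist: `β_{k+1} ≥ 0` on `]0,γ₀]^{k+1}` for all k, some γ₀ > 0.  UNPRINTED (T09.F, weak form). [cite: Balaban1987RG1, §1 p.264 ("other properties in a separate paper")] -/
def BetaSignH (β : HBeta) : Prop := ∃ γ₀ : ℝ, 0 < γ₀ ∧ BetaLowerH 0 γ₀ β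

/-- (β-AF)_hist: a uniform positive lower bound `0 < b ≤ β_{k+1}` on `]0,γ₀]^{k+1}` for all k.  UNPRINTED (T09.F,
strong form; the content of Thm 2's (0.31) lower half in pointwise-sufficient shape). [cite: Balaban1987RG1, Thm 2 (0.31) p.259] -/
def BetaAFH (β : HBeta) : Prop := ∃ γ₀ : ℝ, 0 < γ₀ ∧ ∃ b : ℝ, 0 < b ∧ BetaLowerH b γ₀ β

/-- (β-pert)_hist — the cell's FIRST typing of "second order perturbative calculations" ([Balaban1989LargeFieldII]
p. 355): a k-uniform leading coefficient `β̄` with an `O(γ²)` remainder on the boxes,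
`|β_{k+1}(v) − β̄| ≤ C γ²` for all `v ∈ ]0,γ]^{k+1}`, `γ ≤ γ₀`.  UNPRINTED; a candidate statement, not a quotation.
RIGIDITY CAVEAT (v1.2, G-adv2-18): with the printed one-loop split this forces a k-INDEPENDENT one-loop coefficient
(`BetaPertRigid.beta0_eq_of_pert`, `not_betaPertH_of_two_scales`), which is not expected of (1.22); presumably false
for Bałaban's family — kept as a record, superseded as a target by the partial-sum / drift / limit forms (see the §5
discussion above and `FlowStepRuns` §7, §10). [cite: Balaban1989LargeFieldII, p.355] -/
def BetaPertH (β : HBeta) (βbar : ℝ) : Prop :=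
  ∃ γ₀ : ℝ, 0 < γ₀ ∧ ∃ C : ℝ, 0 ≤ C ∧ ∀ γ, 0 < γ → γ ≤ γ₀ → ∀ k v, v ∈ Box γ k → |β k v - βbar| ≤ C * γ ^ 2

/-- The perturbative form with `β̄ > 0` gives a uniform positive lower bound on smaller boxes
(take `γ₁` with `C γ₁² ≤ β̄/2`). [folklore] -/
theorem betaAFH_of_pert {β : HBeta} {βbar : ℝ} (hbar : 0 < βbar) (h : BetaPertH β βbar) : BetaAFH β := by
  obtain ⟨γ₀, hγ₀, C, hC, h⟩ := h
  -- choose γ₁ ≤ γ₀ with C γ₁² ≤ β̄/2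
  obtain ⟨γ₁, hγ₁, hγ₁₀, hsmall⟩ : ∃ γ₁ : ℝ, 0 < γ₁ ∧ γ₁ ≤ γ₀ ∧ C * γ₁ ^ 2 ≤ βbar / 2 := by
    by_cases hC0 : C = 0
    · exact ⟨γ₀, hγ₀, le_rfl, by rw [hC0]; simp; positivity⟩
    · have hCpos : 0 < C := lt_of_le_of_ne hC (Ne.symm hC0)
      set t : ℝ := min γ₀ (Real.sqrt (βbar / (2 * C))) with ht
      have htpos : 0 < t := lt_min hγ₀ (Real.sqrt_pos.mpr (by positivity))
      refine ⟨t, htpos, min_le_left _ _, ?_⟩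
      have h1 : t ≤ Real.sqrt (βbar / (2 * C)) := min_le_right _ _
      have h2 : t ^ 2 ≤ βbar / (2 * C) := by
        calc t ^ 2 ≤ (Real.sqrt (βbar / (2 * C))) ^ 2 := pow_le_pow_left₀ htpos.le h1 2
          _ = βbar / (2 * C) := Real.sq_sqrt (by positivity)
      calc C * t ^ 2 ≤ C * (βbar / (2 * C)) := mul_le_mul_of_nonneg_left h2 hC
        _ = βbar / 2 := by field_simp
  refine ⟨γ₁, hγ₁, βbar / 2, by positivity, fun k v hv => ?_⟩
  have := h γ₁ hγ₁ hγ₁₀ k v hv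
  have := (abs_sub_le_iff.mp this).2
  linarith

/-- The perturbative form gives a uniform upper bound. [folklore] -/
theorem betaUpperH_of_pert {β : HBeta} {βbar : ℝ} (h : BetaPertH β βbar) :
    ∃ γ₀ : ℝ, 0 < γ₀ ∧ ∃ β' : ℝ, BetaUpperH β' γ₀ β := by
  obtain ⟨γ₀, hγ₀, C, hC, h⟩ := h
  refine ⟨γ₀, hγ₀, βbar + C * γ₀ ^ 2, fun k v hv => ?_⟩
  have := (abs_sub_le_iff.mp (h γ₀ hγ₀ le_rfl k v hv)).1
  linarith

/-- (β-AF)_hist ⇒ (β-sign)_hist. [folklore] -/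
theorem betaSignH_of_AFH {β : HBeta} (h : BetaAFH β) : BetaSignH β := by
  obtain ⟨γ₀, hγ₀, b, hb, hlo⟩ := h
  exact ⟨γ₀, hγ₀, fun k v hv => hb.le.trans (hlo k v hv)⟩

/-- Restriction of box bounds to a smaller γ. [folklore] -/
theorem box_mono {γ γ' : ℝ} (h : γ ≤ γ') (k : ℕ) : Box γ k ⊆ Box γ' k := by
  intro v hv
  exact mem_box.mpr fun i => ⟨(mem_box.mp hv i).1, (mem_box.mp hv i).2.trans h⟩

/-! ## 6. Transport to the construction level: `Missing.B12Thm2Shape` for forward-generated flows (history form)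

`flowOf P g₀ : Setup.Flow` = the couplings the construction generates at parameters `P` from bare coupling `g₀`
(its `Flow.β` field is irrelevant here: Theorem 2 as typed speaks of the couplings only).  Hypotheses: `h0` it starts
at `g₀`; `hfwd` forward generation by (0.20) with the history-dependent β — whenever the trajectory is positive up to
step k and the right side `1/g_k² − β_{k+1}(g_0,…,g_k)` is positive, the next coupling is its positive solution.  This
is the history-dependent version of `Missing.B12Thm2Shape_of_betaBounds` (which it supersedes in scope); forward
UNIQUENESS identifies the construction's run with the shooting trajectory of §3. -/

/-- **`Missing.B12Thm2Shape` ⇐ (continuity ∧ `0 < b ≤ β_{k+1} ≤ b'` on the boxes `]0,γ₀]^{k+1}`) for flows generated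
forward from the bare coupling by (0.20) with history-dependent β.**  A REDUCTION: `hlo` with `b > 0` is the located
unprinted input T09.F. [cite: Balaban1987RG1, Thm 2 (0.31) p.259 and §5 p.298] -/
theorem B12Thm2Shape_of_betaBoundsH (L : ℕ) (hL : Odd L ∧ 1 < L) (flowOf : Params → ℝ → Flow)
    (β : HBeta) {γ₀ b b' : ℝ} (hγ₀ : 0 < γ₀) (hb : 0 < b) (hbb' : b ≤ b')
    (hcont : BetaContH γ₀ β) (hlo : BetaLowerH b γ₀ β) (hup : BetaUpperH b' γ₀ β)
    (h0 : ∀ (P : Params) (g₀ : ℝ), (flowOf P g₀).g 0 = g₀)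
    (hfwd : ∀ (P : Params) (g₀ : ℝ) (k : ℕ), k < P.K → (∀ i, i ≤ k → 0 < (flowOf P g₀).g i) →
      0 < 1 / ((flowOf P g₀).g k) ^ 2 - β k (prefixOf (flowOf P g₀).g k) →
        0 < (flowOf P g₀).g (k + 1) ∧
          1 / ((flowOf P g₀).g (k + 1)) ^ 2 = 1 / ((flowOf P g₀).g k) ^ 2 - β k (prefixOf (flowOf P g₀).g k)) :
    Missing.B12Thm2Shape L hL flowOf := by
  intro m
  refine ⟨γ₀, hγ₀, fun γ hγ hγle => ⟨γ, hγ, fun g hg hgle => ?_⟩⟩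
  have hL1 : (1 : ℝ) < (L : ℝ) := by exact_mod_cast hL.2
  have hlog : 0 < Real.log (L : ℝ) := Real.log_pos hL1
  refine ⟨b / Real.log L, b' / Real.log L, div_pos hb hlog,
    div_le_div_of_nonneg_right hbb' hlog.le, fun K => ?_⟩
  -- restrict the β-hypotheses from the γ₀-boxes to the γ-boxes
  have hcont' : BetaContH γ β := fun k => (hcont k).mono (box_mono hγle k)
  have hlo' : BetaLowerH b γ β := fun k v hv => hlo k v (box_mono hγle k hv)
  have hup' : BetaUpperH b' γ β := fun k v hv => hup k v (box_mono hγle k hv)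
  obtain ⟨gs, hgsK, hrg, hI, hD, -⟩ :=
    couplingTrajectory_exists_hist β hγ hb.le hbb' hcont' hlo' hup' K g hg hgle
  set P : Params := Missing.params4 L hL m K with hP
  have hPK : P.K = K := rfl
  have hPL : P.L = L := rfl
  refine ⟨gs 0, ?_⟩
  -- forward uniqueness (strong form: agreement of the whole prefix)
  have agree : ∀ k, k ≤ K → ∀ i, i ≤ k → (flowOf P (gs 0)).g i = gs i := by
    intro k
    induction k with
    | zero => intro _ i hi; obtain rfl := Nat.le_zero.mp hi; exact h0 P (gs 0)
    | succ k ih =>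
      intro hk i hi
      have hkK : k < K := Nat.lt_of_succ_le hk
      rcases Nat.lt_or_eq_of_le hi with hlt | rfl
      · exact ih hkK.le i (Nat.lt_succ_iff.mp hlt)
      · have hprev : ∀ i, i ≤ k → (flowOf P (gs 0)).g i = gs i := ih hkK.le
        have hpre : prefixOf (flowOf P (gs 0)).g k = prefixOf gs k := by
          funext j; simp [prefixOf, hprev j (Nat.lt_succ_iff.mp j.isLt)]
        have hgk : (flowOf P (gs 0)).g k = gs k := hprev k le_rfl
        have hpos_k1 : 0 < gs (k + 1) := (hI (k + 1) hk).1
        have hrgk : 1 / (gs k) ^ 2 = 1 / (gs (k + 1)) ^ 2 + β k (prefixOf gs k) := hrg k hkK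
        have hrhs : 0 < 1 / (gs k) ^ 2 - β k (prefixOf gs k) := by
          rw [hrgk, add_sub_cancel_right]; positivity
        have hposAll : ∀ i, i ≤ k → 0 < (flowOf P (gs 0)).g i :=
          fun i hi => by rw [hprev i hi]; exact (hI i (hi.trans hkK.le)).1
        obtain ⟨hpos', heq'⟩ := hfwd P (gs 0) k (hPK ▸ hkK) hposAll (by rw [hgk, hpre]; exact hrhs)
        rw [hgk, hpre, hrgk, add_sub_cancel_right] at heq'
        have hsq : ((flowOf P (gs 0)).g (k + 1)) ^ 2 = (gs (k + 1)) ^ 2 := by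
          have h1 : (((flowOf P (gs 0)).g (k + 1)) ^ 2)⁻¹ = ((gs (k + 1)) ^ 2)⁻¹ := by
            simpa only [one_div] using heq'
          exact inv_inj.mp h1
        exact (pow_left_inj₀ hpos'.le hpos_k1.le (by norm_num)).mp hsq
  have agree' : ∀ k, k ≤ K → (flowOf P (gs 0)).g k = gs k := fun k hk => agree K le_rfl k hk
  refine ⟨?_, ?_, ?_⟩
  · intro k hk
    rw [agree' k (hPK ▸ hk)]
    exact hI k (hPK ▸ hk)
  · rw [agree' K le_rfl]; exact hgsK
  · rw [Step.logRunning_iff_discrete031, hPL, hPK, div_mul_cancel₀ b hlog.ne', div_mul_cancel₀ b' hlog.ne']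
    intro k hk
    rw [agree' k hk]
    exact hD k hk

/-- The same transport from the perturbative form: `BetaPertH β β̄` with `β̄ > 0` + continuity ⇒ Theorem 2's shape for
forward-generated flows.  (Chains `betaAFH_of_pert`, `betaUpperH_of_pert`, `B12Thm2Shape_of_betaBoundsH`.) [cite: Balaban1989LargeFieldII, p.355] -/
theorem B12Thm2Shape_of_pertH (L : ℕ) (hL : Odd L ∧ 1 < L) (flowOf : Params → ℝ → Flow)
    (β : HBeta) {βbar γc : ℝ} (hbar : 0 < βbar) (hpert : BetaPertH β βbar) (hγc : 0 < γc)
    (hcont : BetaContH γc β)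
    (h0 : ∀ (P : Params) (g₀ : ℝ), (flowOf P g₀).g 0 = g₀)
    (hfwd : ∀ (P : Params) (g₀ : ℝ) (k : ℕ), k < P.K → (∀ i, i ≤ k → 0 < (flowOf P g₀).g i) →
      0 < 1 / ((flowOf P g₀).g k) ^ 2 - β k (prefixOf (flowOf P g₀).g k) →
        0 < (flowOf P g₀).g (k + 1) ∧
          1 / ((flowOf P g₀).g (k + 1)) ^ 2 = 1 / ((flowOf P g₀).g k) ^ 2 - β k (prefixOf (flowOf P g₀).g k)) :
    Missing.B12Thm2Shape L hL flowOf := by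
  obtain ⟨γ₁, hγ₁, b, hb, hlo⟩ := betaAFH_of_pert hbar hpert
  obtain ⟨γ₂, hγ₂, b'', hup⟩ := betaUpperH_of_pert hpert
  -- common small γ₀ and an upper constant ≥ b
  set γ₀ : ℝ := min γc (min γ₁ γ₂) with hγ₀def
  have hγ₀ : 0 < γ₀ := lt_min hγc (lt_min hγ₁ hγ₂)
  have h0c : γ₀ ≤ γc := min_le_left _ _
  have h01 : γ₀ ≤ γ₁ := (min_le_right _ _).trans (min_le_left _ _)
  have h02 : γ₀ ≤ γ₂ := (min_le_right _ _).trans (min_le_right _ _)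
  refine B12Thm2Shape_of_betaBoundsH L hL flowOf β hγ₀ hb (le_max_left b b'')
    (fun k => (hcont k).mono (box_mono h0c k))
    (fun k v hv => hlo k v (box_mono h01 k hv))
    (fun k v hv => (hup k v (box_mono h02 k hv)).trans (le_max_right _ _)) h0 hfwd

/-! ## 7. End to end in the HISTORY typing: the printed one-loop split (sub-cell B12's `B12Beta.OneLoopSplit`) + (AF-0) +
(AF-1) + upper bound + continuity ⇒ Theorem 2's conclusion, via forward shooting (v1.1)

`B12Beta.thm2Conclusion_of_split` chains the one-loop split with the MARKOV backward construction
`Step.couplingTrajectory_exists`; here the same chain runs through `couplingTrajectory_exists_hist`, so that the cell's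
DAG input T09.F is ONE typed statement in the printed (history-dependent) setting: (AF-0) `inf_k β⁰_{k+1} > 0` — the
one-loop asymptotic freedom of Bałaban's block-averaging scheme, uniformly in the scale ((M2) of the cell's
MISSING-B12.md; "second order perturbative calculations", [Balaban1989LargeFieldII] p. 355) — and (AF-1) a k-uniform
`O(g_k)` bound on the remainder β¹ ((M1); the p. 264 clause "uniformly bounded … with all derivatives", unproved in print).
NEITHER is printed; nothing of the series is asserted. -/

/-- Sub-cell B12's `HistBox` IS this module's `Box` (both = ]0,γ]^{k+1}). [folklore] -/
theorem histBox_eq_box (γ : ℝ) (k : ℕ) : B12Beta.HistBox γ k = Box γ k := by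
  ext v; simp [B12Beta.HistBox, mem_box]

/-- (β-AF)_hist on the boxes from the one-loop split: `2b ≤ β⁰_{k+1}` ∀ k, `|β¹_{k+1}| ≤ C g_k` on ]0,γ]^{k+1}, `Cγ ≤ b`
⟹ `BetaLowerH b γ β` (= `B12Beta.betaLowerHist_of_split` read through `histBox_eq_box`). [folklore] -/
theorem betaLowerH_of_split {β : HBeta} (S : B12Beta.OneLoopSplit β) {b C γ : ℝ}
    (hAF0 : ∀ k, 2 * b ≤ S.β0 k)
    (hAF1 : ∀ k (p : Fin (k + 1) → ℝ), p ∈ B12Beta.HistBox γ k → |S.β1 k p| ≤ C * p (Fin.last k))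
    (hC : 0 ≤ C) (hγ : C * γ ≤ b) : BetaLowerH b γ β := by
  intro k v hv
  exact B12Beta.betaLowerHist_of_split S hAF0 hAF1 hC hγ k v ((histBox_eq_box γ k).symm ▸ hv)

/-- **End to end, history typing.**  The printed one-loop split `β_{k+1} = β⁰_{k+1} + β¹_{k+1}(g_0,…,g_k)` with
(AF-0) `2b ≤ β⁰_{k+1}` (b > 0), (AF-1) `|β¹_{k+1}| ≤ C g_k` on ]0,γ]^{k+1}, `Cγ ≤ b`, an upper bound `β_{k+1} ≤ β'` and
joint continuity on the boxes yield the CONCLUSION of [Balaban1987RG1] Theorem 2: for every `K` and renormalised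
`g ∈ ]0,γ]` a bare coupling whose forward trajectory solves (0.20), lies in ]0,γ], is non-decreasing, ends at `g_K = g`
and obeys the discrete (0.31) with `b, β'`.  A REDUCTION: (AF-0), (AF-1), the upper bound and the continuity are
hypotheses whose proofs are not in print (cell GAPS G-b12-1/2, G-sb12-1). [cite: Balaban1987RG1, Thm 2 p.259 and (2.12)–(2.14) p.268] -/
theorem thm2Conclusion_of_split_hist {β : HBeta} (S : B12Beta.OneLoopSplit β) {b C γ β' : ℝ}
    (hγ0 : 0 < γ) (hb : 0 < b) (hAF0 : ∀ k, 2 * b ≤ S.β0 k)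
    (hAF1 : ∀ k (p : Fin (k + 1) → ℝ), p ∈ B12Beta.HistBox γ k → |S.β1 k p| ≤ C * p (Fin.last k))
    (hC : 0 ≤ C) (hγ : C * γ ≤ b) (hU : BetaUpperH β' γ β) (hcont : BetaContH γ β) :
    ∀ (K : ℕ) (g : ℝ), 0 < g → g ≤ γ →
      ∃ gs : ℕ → ℝ, gs K = g ∧ RGEqH K β gs ∧ Step.InInterval γ K gs ∧
        Step.Discrete031 b β' K g gs ∧ ∀ k, k < K → gs k ≤ gs (k + 1) := by
  have hL : BetaLowerH b γ β := betaLowerH_of_split S hAF0 hAF1 hC hγ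
  -- b ≤ β' by evaluating both bounds at the constant history γ of length 1
  have hmem : (fun _ : Fin (0 + 1) => γ) ∈ Box γ 0 := mem_box.mpr fun _ => ⟨hγ0, le_rfl⟩
  have hbβ : b ≤ β' := (hL 0 _ hmem).trans (hU 0 _ hmem)
  exact couplingTrajectory_exists_hist β hγ0 hb.le hbβ hcont hL hU

/-- The same, transported to the construction level (`Missing.B12Thm2Shape`) for flows generated forward from the bare
coupling — the history-typed counterpart of `B12Beta.thm2Conclusion_of_split` + `Missing.B12Thm2Shape_of_betaBounds`. [cite: Balaban1987RG1, Thm 2 (0.31) p.259] -/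
theorem B12Thm2Shape_of_split_hist (L : ℕ) (hL : Odd L ∧ 1 < L) (flowOf : Params → ℝ → Flow)
    {β : HBeta} (S : B12Beta.OneLoopSplit β) {b C γ β' : ℝ}
    (hγ0 : 0 < γ) (hb : 0 < b) (hAF0 : ∀ k, 2 * b ≤ S.β0 k)
    (hAF1 : ∀ k (p : Fin (k + 1) → ℝ), p ∈ B12Beta.HistBox γ k → |S.β1 k p| ≤ C * p (Fin.last k))
    (hC : 0 ≤ C) (hγ : C * γ ≤ b) (hU : BetaUpperH β' γ β) (hcont : BetaContH γ β)
    (h0 : ∀ (P : Params) (g₀ : ℝ), (flowOf P g₀).g 0 = g₀)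
    (hfwd : ∀ (P : Params) (g₀ : ℝ) (k : ℕ), k < P.K → (∀ i, i ≤ k → 0 < (flowOf P g₀).g i) →
      0 < 1 / ((flowOf P g₀).g k) ^ 2 - β k (prefixOf (flowOf P g₀).g k) →
        0 < (flowOf P g₀).g (k + 1) ∧
          1 / ((flowOf P g₀).g (k + 1)) ^ 2 = 1 / ((flowOf P g₀).g k) ^ 2 - β k (prefixOf (flowOf P g₀).g k)) :
    Missing.B12Thm2Shape L hL flowOf := by
  have hLo : BetaLowerH b γ β := betaLowerH_of_split S hAF0 hAF1 hC hγ
  have hmem : (fun _ : Fin (0 + 1) => γ) ∈ Box γ 0 := mem_box.mpr fun _ => ⟨hγ0, le_rfl⟩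
  have hbβ : b ≤ β' := (hLo 0 _ hmem).trans (hU 0 _ hmem)
  exact B12Thm2Shape_of_betaBoundsH L hL flowOf β hγ0 hb hbβ hcont hLo hU h0 hfwd

end

end Literature.MathematicalPhysics.QuantumFieldTheory.Balaban1983to89.FlowStep
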